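import Mathlib
import HarnessLib
import HarnessLib.Audit
import Summits.CriticalPhenomena.Statement

/-!
Route: HelsonAxis

DORMANT since 2026-09-03T10:20:10Z (reconciler: no traction for 5 d (last activity statement-checked at 2026-08-29T09:24:49Z); parked, not closed — `ledger route dormant route-CriticalPhenomena-HelsonAxis --off` to reactivate) — unstaffed, not closed; items shared with open routes are served there. `ledger route dormant <id> --off` reactivates.

# Route HelsonAxis — Helson positivity on lattice rays kills limit cycles and forces η with its
amplitude

It suffices to show X = CONE₂ ∧ EB ∧ A2I ∧ COMP. CONE₂ (AxialHelsonCone — the lever, from card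
helson-positivity-transfer-axis-v2 K1 = HP,
RESTATED at rev 6 (route-repair g4, 2026-08-17) to its load-bearing ORDER-2 part): along the
TRANSFER AXIS the critical two-point function
g(m) := ⟨σ₀σ_{m e₁}⟩_{β_c(3)} of the n.n. Ising model on ℤ³ has eventually non-negative 2×2 HELSON
MINORS — g(Nb)² ≤ g(N)·g(Nb²) for all
N ≥ ℓ₀ and all integers b ≥ 1, i.e. m ↦ log g(N·b^m) is convex along every geometric ray (g read on
the multiplicative semigroup (ℕ,·);
MULTIPLICATIVE log-convexity, not the in-tree additive one). The card's FULL cone — every matrix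
[g(ℓ·a_i a_j)]_{i,j} positive semidefinite,
a moment sequence over prime exponents (Perfekt–Pushnitski Thm 3.3), Bohr diagonal = complete
monotonicity of t ↦ g(e^t) — implies CONE₂ by
its k = 2 minors (Sketch `cone_weakens`, checked) and stays a sufficient condition and the card's
conjecture, not an item: `closes` never used
its k ≥ 3 minors. EB (EtaBoundsExist,
shared item 4662): two-sided power bounds with one exponent — the atom at the top rate. A2I
(AxisToIsotropicLaw): the axial pure power law
WITH amplitude propagates off the axis to the isotropic cofinite law (item 0634) — the explicit home
of off-axis existence and amplitude
isotropy (MMS sandwich, nine-mirror RP, the PROVED rigidities HRP2Rigidity 1979 / GSMRigidity 8366 /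
OneAmplitudeIsotropy 8369). COMP
(TwoPointSpineComplement, shared item 4497): the conjunct given the two-point law. Support
HelsonForcing: CONE₂ + EB ⇒ g(n)·n^{2Δ} → A > 0
(the forcing theorem kills every log-periodic or wandering modulation that bounds and reflection
positivity still allow; a sorry-free
candidate proof using exactly the 2×2 minors is attached to item 17972).
Lean: `(∃ ℓ₀ : ℕ, 0 < ℓ₀ ∧ ∀ N b : ℕ, ℓ₀ ≤ N → 1 ≤ b →
Literature.Probability.LatticeModels.criticalTwoPoint 3 (Pi.single (0 : Fin 3) ((N * b : ℕ) : ℤ)) ^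
2 ≤ Literature.Probability.LatticeModels.criticalTwoPoint 3 (Pi.single (0 : Fin 3) ((N : ℕ) : ℤ)) *
Literature.Probability.LatticeModels.criticalTwoPoint 3 (Pi.single (0 : Fin 3) ((N * b ^ 2 : ℕ) :
ℤ))) ∧ (∃ η : ℝ, Literature.Probability.LatticeModels.HasIsingEtaBounds 3 η) ∧ AxisToIsotropicLaw ∧
TwoPointSpineComplement`

## Assembly
Pure logic (sorry-free, `closes` in glue.lean, certified): HelsonForcing applied to AxialHelsonCone
and EtaBoundsExist gives the axial pure
power law with amplitude; AxisToIsotropicLaw turns it into the isotropic cofinite law 0634 with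
witnesses Δ, c > 0; TwoPointSpineComplement at
(Δ, c) returns ρ, S with 0 < Δ, the full pointwise limit, non-degeneracy, Möbius covariance and U₄ ≢
0, i.e. the conjunct (the deciding
theorem is `closes`, which PROVES the frame item Assembly inline and applies it — Assembly is in the
cone of `closes`, bc6 6/6).

Rationale: WHY THIS LINE. Existence of η on ℤ³ — already the radial two-point scaling limit — is open
(DuminilCopinICM2022 §8.4 p.29) and the counterexample class is
exactly an RG limit cycle / wandering exponent of the axial function, which reflection positivity
only damps (strip bound e^{−πω/2},
arXiv:1303.5971) and two-sided bounds (DuminilcopinPanis2025, EB) cannot exclude. The lever imports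
the operator theory of Helson matrices
(arXiv:1611.03772, Perfekt–Pushnitski 2018, Thm 3.3 and §5: non-negative Helson matrices = moment
sequences over prime exponents, Bohr
lift = complete monotonicity in log-distance) and Erdős 1946 (monotone multiplicative functions are
powers): positivity on (ℕ,·) is to
limit cycles what RP (positivity on (ℕ,+), Hausdorff moments, arXiv:1912.07973 Prop 4.6) is to
masses; with MMS monotonicity and RP
ratio-continuity the forcing theorem gives ONE exponent and an amplitude. Only the ORDER-2 part of
the cone is load-bearing (the forcing theorem uses the 2×2 minors
g(Nb)² ≤ g(N)g(Nb²) alone — refuter-attached sorry-free proof on item 17972), so since rev 6 the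
crux IS that part: multiplicative log-convexity of
the axial function along geometric rays, which the in-tree ADDITIVE log-convexity g(n)² ≤
g(n−1)g(n+1) (criticalTwoPoint_axis_sq_le, ADC21) does
not give — every transfer-matrix mass mode λⁿ is log-CONCAVE in log n, only the critical mixture can
be convex — and which neither S nor the
η-bounds imply (it is a sign condition on the corrections to scaling). The cone is posited where the
card's anchors live — the transfer axis (the free massless axis IS Bohr-diagonal in every d ≥ 3,
card P2; diagonals are not) — and the off-axis step is isolated as its own crux instead of being
smuggled into an all-rays positivity that
the cubic harmonic Y₄ (opposite signs on axis and body diagonal at order r^{−ω_NR}) would break at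
high minors. No open route reads the
two-point function on the multiplicative semigroup: InverseSquareTelemetry engines the same node
0634 by additive potential theory (effective potential ΔG/G, Agmon–Murata),
BernsteinTemperature by absolute monotonicity in tanh β, GaussianScaleMixture by complete
monotonicity in |x|² (for isotropy); the
negatives index has nothing in this sub-problem. Downstream the line docks into shared decls (0634,
4497, ∃η HasIsingEtaBounds) so every
piece it does not own is already wanted by InverseSquareTelemetry / ClusterRigidity /
CoerciveSharpness.

RANKED CRUXES. #2 AxialHelsonCone (crux) — ORDER-2 HELSON CONE on the transfer axis (restated at rev
6 from the card's full cone K1 = HP to the part `closes` consumes): there is ℓ₀ > 0 such that for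
all N ≥ ℓ₀ and all integers b ≥ 1, ⟨σ₀σ_{Nb e₁}⟩² ≤ ⟨σ₀σ_{N e₁}⟩·⟨σ₀σ_{Nb² e₁}⟩ at β_c(3) — every
2×2 Helson minor [g(N a_i a_j)] with a = (1, b) is ≥ 0, i.e. m ↦ log g(N b^m) is midpoint-convex
along every geometric ray; equivalently the local exponent s_eff is eventually non-increasing along
geometric progressions, which kills log-periodic (limit-cycle) and wandering modulations (by cubic
symmetry the same on every axis). The full cone (all k; g on geometric rays a positive mixture of
pure powers) implies it (`cone_weakens`, checked) and is kept as a sufficient condition only: it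
needs EVERY axial Wegner correction amplitude ≥ 0 (one negative amplitude at any order makes large-k
Hankel minors [g(ℓ 2^{i+j})] negative at large ℓ), far more than the line uses. [difficulty:
open-problem] (why it might fail: Eventual multiplicative log-convexity ⇔ the leading axial
correction amplitude is positive: g ≈ A n^{−2Δ}(1 + b n^{−ω} + c n^{−2}) gives u''(t) = bω²e^{−ωt} +
4c e^{−2t} for u = log g∘exp; MC (j022798/800): c ≈ +0.3, |b| ≲ 0.02 sign unresolved — b < 0 turns
the 2×2 minors negative beyond N ~ 40.) [arXiv:1611.03772, arXiv:1004.4486, arXiv:1912.07973,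
AizenmanDuminilCopinAnnals2021, DuminilCopinICM2022]
#3 AxisToIsotropicLaw (crux) — the axial pure power law with amplitude (∃ Δ, A > 0: ⟨σ₀σ_{n
e₁}⟩_{β_c}·n^{2Δ} → A) propagates to the isotropic cofinite law ⟨σ₀σ_x⟩_{β_c}·|x|₂^{2Δ'} → c > 0
(item 0634): off-axis existence and amplitude isotropy from the axis, through the MMS ℓ¹/ℓ^∞
sandwich, nine-mirror reflection positivity (the six face diagonals are transfer directions too) and
the PROVED rigidities (HRP2Rigidity 1979; GSMRigidity 8366 and OneAmplitudeIsotropy 8369 if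
CriticalTwoPointGSM 8365 is available: isotropy ⇔ one amplitude identity A(e₁) = A((e₁+e₂)/√2)).
[difficulty: open-problem] (why it might fail: Axis convergence does not control off-axis amplitudes
by MMS alone (G(x)|x|^{2Δ} is only squeezed within a factor 3^Δ); a transfer principle axis ⇒ face
diagonal ⇒ all rays (GSM corner structure or a cross-direction Hölder modulus) is not in print.)
[MessagerMiracleSoleJSP1977, arXiv:1912.07973, stmt-CriticalPhenomena-1979,
stmt-CriticalPhenomena-8365, DuminilCopinICM2022]
#4 TwoPointSpineComplement (crux) — the conjunct given the two-point law with its witnesses exposed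
(shared item 4497 of InverseSquareTelemetry): for every Δ and c > 0, if ⟨σ₀σ_x⟩_{β_c}|x|₂^{2Δ} → c
cofinitely then there are ρ > 0 on (0,1] and S with 0 < Δ, HasPointwiseScalingLimit (criticalCorr 3)
ρ S, IsNondegenerateTwoPoint S, IsMoebiusCovariant Δ S and HasNontrivialU4 S; what remains inside it
is n ≥ 3 existence/uniqueness (item 1981 at this Δ), inversion (1982) and U₄ ≢ 0 (0636), rotations
being PROVED given existence (1980). [difficulty: open-problem] (why it might fail: It is the
conjunct given the two-point law: n ≥ 3 existence/uniqueness, inversion covariance and U₄ ≢ 0 on ℤ³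
are each open (ICM 2022 §8.4); inherits ScaleCovarianceNotMoebius, LiouvilleRigidity,
IsingTrivialityFromDimensionFour unmitigated.) [DuminilCopinICM2022, PolandRychkovVichi2019,
AizenmanDuminilCopinAnnals2021, stmt-CriticalPhenomena-0636, stmt-CriticalPhenomena-1982]
#5 EtaBoundsExist (crux) — two-sided power bounds with ONE exponent for the critical two-point
function on ℤ³: ∃ η, c‖x‖^{−(1+η)} ≤ ⟨σ₀σ_x⟩_{β_c(3)} ≤ C‖x‖^{−(1+η)} (shared with ClusterRigidity /
CoerciveSharpness; in-tree window c|x|^{−2} ≤ G ≤ C|x|^{−1}, η ≤ 1/2 if η exists). Supplies the atom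
at the top rate (positivity of the ray amplitudes) in HelsonForcing. [difficulty: open-problem] (why
it might fail: Matching upper and lower powers at β_c(3) are open: the rigorous window is c|x|^{−2}
≤ G ≤ C|x|^{−1} (IR bound, Simon–Lieb) and DC–Panis 2025 only narrows it (η ≤ 1/2 IF η exists); no
sliding-scale argument closes the gap in d = 3.) [DuminilcopinPanis2025, DuminilCopinICM2022,
AizenmanDuminilCopinSidoravicius2015]
#9 HelsonForcing (support) — the forcing theorem on the axis: AxialHelsonCone → EtaBoundsExist → ∃
Δ, A > 0 with g(n)·n^{2Δ} → A. PROVED as a candidate (refuter-rreview, `theorem helsonForcing :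
HelsonForcing`, HelsonForcingProof.lean on item 17972, 2026-08-17T10:43Z, lean rc 0, written against
rev ≤ 5): with φ(n) := g(n)·n^{1+η} ∈ [c, C] (EtaBoundsExist) the 2×2 minors make
φ(Nb^{j+1})/φ(Nb^j) nondecreasing in j, so boundedness forces DIVISIBILITY MONOTONICITY φ(Nb) ≤ φ(N)
(N ≥ ℓ₀, b ≥ 1); with the in-tree axis antitonicity / ratio-continuity g(n+1)/g(n) → 1
(criticalTwoPoint_axis_succ_le, criticalTwoPoint_axis_ratio_tendsto_one',
CriticalAxisRatioRegularity.lean) φ(n) → A := inf_{N ≥ ℓ₀} φ(N) ≥ c > 0 and 2Δ = 1 + η. AFTER THE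
REV-6 RESTATE the inequality that proof extracted from `Matrix.PosSemidef` (k = 2, a = (1, r), det ≥
0) is the hypothesis itself: to land it, delete the extraction step and use the cone hypothesis at
(N, b) directly (everything else unchanged). [difficulty: S] [arXiv:1912.07973, arXiv:1611.03772,
DuminilcopinPanis2025]

TWO-LAYER PLAN. AxisToIsotropicLaw ⇐ AxisToFaceDiagonal (the face-diagonal function, a Hausdorff
moment sequence by diagonal RP, inherits the axial law with an
amplitude A_d) → ProfileFromTwoTransferDirections (MMS + nine-mirror RP + a cross-direction modulus
give a continuous homogeneous limit kernel
with K(e₁) = A, K((e₁+e₂)/√2) = A_d) → AxisToIsotropicLaw, with HRP2Rigidity 1979 (PROVED) or, under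
CriticalTwoPointGSM 8365,
OneAmplitudeIsotropy 8369 (PROVED) as by-name supports. TwoPointSpineComplement ⇐ ExistsAtDelta
(item 1981 at the two-point Δ) → [1982] →
[0636] → 4497 (LimitRotationInvariant 1980 PROVED supplies O(3)) —
bc/TwoPointSpineComplement_birth.lean. AxialHelsonCone (order 2) ⇐ the card's full cone /
BohrDiagonalAxis
(complete monotonicity of t ↦ g(e^t) from n₀: a positive mixture of pure powers n^{−s} is log-convex
in log n by Cauchy–Schwarz) — sufficient, not
necessary; or ⇐ SignOfLeadingCorrection (b > 0 in g ≈ A n^{−2Δ}(1 + b n^{−ω} + …)) →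
LogScaleC2Remainder (second multiplicative differences of the
remainder are o(b n^{−ω}) uniformly) → AxialHelsonCone. No skeleton registered for the restated item
yet (tenure).

KILL CRITERIA. AxialHelsonCone refuted — a persistent NEGATIVE 2×2 Helson minor g(Nb)² > g(N)g(Nb²)
at arbitrarily large N on the axis (s_eff increasing
along a geometric ray); in practice the axial corrections-to-scaling amplitude b < 0 for spin-1/2
(s_eff(n) rising to 2Δ from BELOW in converged
infinite-volume Monte-Carlo, then an interval bound or a theorem) — closes the route
`refuted:AxialHelsonCone` and files the sign as negative knowledge for
every 'positivity in scale' line. Since rev 6 the crux IS the load-bearing order-2 part, so negative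
k ≥ 3 Helson/Gram minors (one 4×4 at ℓ = 2 is −3σ in
the MC) no longer touch the route: they bear on the card's full-cone conjecture only.
AxisToIsotropicLaw refuted (an axis law that does not propagate) would be a structural surprise
contradicting S itself at that Δ.
EtaBoundsExist or 0634 proved elsewhere does NOT moot the route (the cone still upgrades bounds to a
limit); 0634 proved elsewhere moots the
cone's role — then close `superseded`. A refutation of TwoPointSpineComplement at the true Δ is ¬S.

NOT DECOMPOSED YET. The transfer principle inside AxisToIsotropicLaw (layer-2 children above; shared
in spirit with GaussianScaleMixture and
MirrorHoelderCompactness); nothing inside HelsonForcing (one support; candidate proof on item 17972,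
to be landed with the one-line adaptation noted under #9); the three
pillars inside TwoPointSpineComplement (shared items 1981/1982/0636, decomposed on their home
routes); the free-axis anchor (card P2: the
massless lattice Green function on the axis is Bohr-diagonal in every d ≥ 3) — a calibration lemma
provers may land with `--supports
AxialHelsonCone`; the card's FULL Helson cone (all k) and Helson positivity on the six face-diagonal
transfer directions (plausible,
not needed by `closes`, deliberately not filed as items).

CHEAPEST FALSIFIER. MC of the AXIAL function at β_c — RUN this cycle (kit j022798 + j022800: Wolff,
L = 64/128/256, 48 replicas; G_∞(1) = 0.330203(7) vs
ε_cr = 0.3302022(5)): (a) s_eff(n) decreases monotonically from n = 2 (whole window n ≤ 31) and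
approaches 2Δ = 1.0363 FROM ABOVE —
three-size infinite-volume values 1.1321(2), 1.0745(4), 1.0519(6), 1.0453(9), 1.0424(14), 1.0403(16)
at n = 2, 4, 6, 8, 10, 12 (+4.4σ at
n = 10; ≈ 2Δ within errors at 13–15); (b) every 2×2 Helson minor with ℓ ≥ 2 is POSITIVE (13–270σ) up
to n = 32, only minors through n = 1 are
negative; 3×3 Gram minors positive at ℓ = 2, 3; one 4×4 at ℓ = 2 is −3σ (n = 2, 4 lattice zone; ℓ₀ =
3 clears it). (c) NOT decided: the
excess decays like n^{−2} (analytic lattice term, as the free anchor's +1/4n²), the universal b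
n^{−0.83} amplitude is |b| ≲ 0.02 with sign
unresolved (a one-term extrapolation dips 0.005–0.02 below 2Δ beyond n ≈ 12 but is demonstrably
under-corrected there). Decisive remaining
check, cheap for a refuter and THEORETICAL: sign(b) = sign(g_ε′ of sc spin-1/2) × sign(first-order
conformal-perturbation integral with C_σσε′);
b < 0 kills AxialHelsonCone (the 2×2 minors turn negative near N ~ 40), b > 0 leaves it standing.

NUMBERS. 2Δ_σ = 1.036298 (bootstrap), ω = 0.8297, Δ_ε = 1.41263, ω_NR ≈ 2.02; β_c(sc) =
0.221654626(5); ⟨σ₀σ_{e₁}⟩_{β_c} = ε_cr = 0.3302022(5)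
(arXiv:1501.04065 §3.1) — MC here: 0.330203(7). Rigorous: c|x|^{−2} ≤ G ≤ C|x|^{−1}; η ≤ 1/2 if it
exists (DuminilcopinPanis2025 Thm 1.5).
MC (j022798/j022800, tables in the planner folder jobs/merged_AB.txt, jobs/threesize.py):
infinite-volume axial G(n), n = 1…8: 0.330203,
0.160696, 0.101553, 0.073965, 0.058203, 0.047990, 0.040813, 0.035493 (±2·10⁻⁵); s_eff(1→2) =
1.0390(1) (lattice zone), peak s_eff(2→3) =
1.1319(2), then monotone decrease to 1.040(2) at n = 12; fitted analytic coefficient c ≈ +0.3 (g ≈ A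
n^{−2Δ}(1 + b n^{−ω} + c n^{−2})), |b| ≲ 0.02.
Items: 6 (4 cruxes — 2 new, 2 shared — 1 support, 1 assembly); rev 6 (route-repair g4) restated
AxialHelsonCone to its order-2 part, same decl name, new item.

DEFINITION REQUESTS. None: criticalTwoPoint, HasIsingEtaBounds, Matrix.PosSemidef, CorrFamily,
HasPointwiseScalingLimit exist.

Novelty: Searches (2026-08-17): `lit frontier CriticalPhenomena --since 2023` (30 rows; none on existence of
η in d = 3; 3D loop-soup/GFF items
read: arXiv:2601.04840, 2510.20526); `lit search --source arxiv` ×6 (DC–Panis 2404.05700 read §1;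
Caselle et al. 1501.04065 read §3);
the 53 open route files (levers listed in NOTES.md; grep of all Theses for
Helson/multiplicative/Bohr: 0 hits); the 130 cards of the
sub (critic grade of the spine card: new-mechanism, 2026-08-16, with its own searches: zbMATH
'Helson matrices', openalex 'Helson matrices
moment problems' — operator theory only).
Nearest prior art found: arXiv:1611.03772 (Perfekt–Pushnitski: non-negative Helson matrices = moment
sequences; pure operator theory);
arXiv:1912.07973 Prop 4.6 (RP = complete monotonicity on the additive semigroup); route
InverseSquareTelemetry (same node 0634 by
additive potential theory); route BernsteinTemperature (absolute monotonicity in tanh β).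
Delta: the first use of positivity on the MULTIPLICATIVE semigroup of distances (Helson moments) on
any lattice model — it converts
'η exists with an amplitude' into a cone condition with finite exact tests and a forcing theorem, a
mechanism none of the 53 open routes
or the literature searched employs.
Claimed grade: new-mechanism  [refs: 2601.04840, 1611.03772, 1912.07973]

Barriers (technique_class: helson-positivity, log-scale-CM, regular-variation): - technique_class: helson-positivity, log-scale-CM, regular-variation
- Literature.Barriers.CriticalPhenomena.RigorousRGSmallParameter: evaded — no RG map and no
expansion parameter; the (ℕ,·) re-rooting action is exact bookkeeping on one observable and the
positivity is a property of ⟨σ₀σ_x⟩ itself.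
- Literature.Barriers.CriticalPhenomena.PositionSpaceRGNonGibbsian: evaded — no renormalised
measures occur; only the two-point function along kℤu.
- Literature.Barriers.CriticalPhenomena.BootstrapLatticeBlindness: evaded — model-specific inputs
(transfer-axis RP, MMS, Simon–Lieb) and a model-specific prediction (HP fails on the Gaussian side
of the improved point and on diagonals of the free/2D anchors).
- Literature.Barriers.CriticalPhenomena.ScaleCovarianceNotMoebius: not engaged by the lever
(two-point existence only); it bites inside the shared TwoPointSpineComplement exactly as on its
home routes (inversion item 1982 must use the Ising hypothesis).
- Literature.Barriers.CriticalPhenomena.LiouvilleRigidity: not engaged (no conformal maps beyond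
Möbius are used; inversion is imported via 4497).
- Literature.Barriers.CriticalPhenomena.IsingTrivialityFromDimensionFour: not engaged by the lever;
U₄ ≢ 0 sits inside 4497 (item 0636) with its d = 3-specific obligations.
- Negatives index: 11 refuted statements of the summit (Cardy/SAW/Perc only), none in this sub; the
in-file refutations (IsingEuclidUpgrade 0637, IsingCFTData) concern ∀ρ-quantified upgrades —
avoided: 4497's conclu

History (route lifecycle, newest last):
- 2026-08-17T11:47:09Z · rev 6: restated AxialHelsonCone (stmt-CriticalPhenomena-17970) — route-repair g4 (rbadge; payload reason bc6 route.declared-not-in-cone: Assembly = STALE birth stamp 09:28:52Z — natively the cone is 6/6 since rev 1, closes ce (planner-rbadge-CriticalPhenomena-HelsonAxis-8392421f-g4-0)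
- 2026-08-26T09:37:39Z · DORMANT — reconciler: no traction for 8.4 d (last activity item-evidence-added at 2026-08-17T23:05:48Z); parked, not closed — `ledger route dormant route-CriticalPhenomen (operator:999:890431)
- 2026-08-26T10:17:33Z · REACTIVATED — reconciler: reactivated — activity route-repaired at 2026-08-26T09:37:51Z after parking at 2026-08-26T09:37:39Z (operator:999:4051601)
- 2026-09-03T10:20:10Z · DORMANT — reconciler: no traction for 5 d (last activity statement-checked at 2026-08-29T09:24:49Z); parked, not closed — `ledger route dormant route-CriticalPhenomena-He (operator:999:390265)

sub-problem: Ising3DConformalLimit · status: dormant · opened planner-plan-novel-CriticalPhenomena-Ising3DCon-3ad144fc-v2-g16-0 2026-08-17T09:27:12Z · rev 7 · ledger route-CriticalPhenomena-HelsonAxis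
GENERATED by the gate from the ledger (D-0016/17). Provers cite these decls: `theorem foo : Summit.CriticalPhenomena.Ising3DConformalLimit.Theses.HelsonAxis.<Decl> := …` in Summits/CriticalPhenomena/Ising3DConformalLimit/Theorems/<Name>.lean.
-/

namespace Summit.CriticalPhenomena.Ising3DConformalLimit.Theses.HelsonAxis

open scoped BigOperators Topology Manifold Classical MeasureTheory ProbabilityTheory Matrix InnerProductSpace ComplexConjugate ContinuousMap
open Filter Set Function TopologicalSpace MeasureTheory

attribute [summit_statement] _root_.Ising3DConformalLimit

-- earlier AxialHelsonCone (stmt-CriticalPhenomena-17970, replaced 2026-08-17T11:47:09Z -> stmt-CriticalPhenomena-18121): retired by None — ∃ ℓ₀ : ℕ, 0 < ℓ₀ ∧ ∀ ℓ : ℕ, ℓ₀ ≤ ℓ → ∀ (k : ℕ) (a : Fin k → ℕ), (∀ i, 0 < a i) → (Matrix.of fun i j : Fin k => Literature.Probability.LatticeModels.criticalTwoPoint 3 (Pi.single (0 : Fin 3) ((ℓ * a i * a j : ℕ) : ℤ))).PosSemidef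
/-- item stmt-CriticalPhenomena-18121 · crux · rank 2 · open · by planner
why it might fail: Eventual multiplicative log-convexity ⇔ leading axial correction amplitude b > 0 (g ≈ A n^{−2Δ}(1 + b n^{−ω} + c n^{−2}), u'' = bω²e^{−ωt} + 4c e^{−2t}); MC j022798/800: c ≈ +0.3 but |b| ≲ 0.02, sign unresolved — b < 0 turns the 2×2 minors negative beyond N ~ 40.
sources: arXiv:1611.03772, arXiv:1004.4486, arXiv:1912.07973, AizenmanDuminilCopinAnnals2021, DuminilCopinICM2022
[crux] ORDER-2 HELSON CONE on the transfer axis — the load-bearing part of card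
helson-positivity-transfer-axis-v2 K1 = HP (restated at rev 6, route-repair g4, from the full all-k
cone, whose k ≥ 3 minors `closes` never used): there is ℓ₀ > 0 such that for all N ≥ ℓ₀ and all
integers b ≥ 1, ⟨σ₀σ_{Nb e₁}⟩² ≤ ⟨σ₀σ_{N e₁}⟩·⟨σ₀σ_{Nb² e₁}⟩ at β_c(3) — every 2×2 Helson minor [g(N
a_i a_j)] with a = (1, b) is ≥ 0, i.e. m ↦ log g(N b^m) is midpoint-convex along every geometric ray
(MULTIPLICATIVE log-convexity: the in-tree additive log-convexity g(n)² ≤ g(n−1)g(n+1),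
criticalTwoPoint_axis_sq_le, does not give it — each transfer-matrix mass mode λⁿ is log-concave in
log n, only the critical mixture can be convex; nor do S or the η-bounds: it is a sign condition on
the corrections to scaling). Equivalently the local exponent s_eff is eventually non-increasing
along geometric progressions; it kills log-periodic (limit-cycle) and wandering modulations, and
with EtaBoundsExist forces g(n)·n^{2Δ} → A > 0 (HelsonForcing, candidate proof on item 17972). The
card's full cone (g on geometric rays a positive mixture of pure powers, Perfekt–Pushnitski Thm 3.3)
implies it by its k = 2 minors (planner S -/
@[route_item "route-CriticalPhenomena-HelsonAxis"]
def AxialHelsonCone : Prop :=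
  ∃ ℓ₀ : ℕ, 0 < ℓ₀ ∧ ∀ N b : ℕ, ℓ₀ ≤ N → 1 ≤ b → Literature.Probability.LatticeModels.criticalTwoPoint 3 (Pi.single (0 : Fin 3) ((N * b : ℕ) : ℤ)) ^ 2 ≤ Literature.Probability.LatticeModels.criticalTwoPoint 3 (Pi.single (0 : Fin 3) ((N : ℕ) : ℤ)) * Literature.Probability.LatticeModels.criticalTwoPoint 3 (Pi.single (0 : Fin 3) ((N * b ^ 2 : ℕ) : ℤ))

/-- item stmt-CriticalPhenomena-17971 · crux · rank 3 · open · by planner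
why it might fail: Axis convergence does not control off-axis amplitudes by MMS alone (G(x)|x|^{2Δ} is only squeezed within a factor 3^Δ); a transfer principle axis ⇒ face diagonal ⇒ all rays (GSM corner structure or a cross-direction Hölder modulus) is not in print.
sources: MessagerMiracleSoleJSP1977, arXiv:1912.07973, stmt-CriticalPhenomena-1979, stmt-CriticalPhenomena-8365, DuminilCopinICM2022
[crux] the axial pure power law with amplitude (∃ Δ, A > 0: ⟨σ₀σ_{n e₁}⟩_{β_c}·n^{2Δ} → A)
propagates to the isotropic cofinite law ⟨σ₀σ_x⟩_{β_c}·|x|₂^{2Δ'} → c > 0 (item 0634): off-axis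
existence and amplitude isotropy from the axis, through the MMS ℓ¹/ℓ^∞ sandwich, nine-mirror
reflection positivity (the six face diagonals are transfer directions too) and the PROVED rigidities
(HRP2Rigidity 1979; GSMRigidity 8366 and OneAmplitudeIsotropy 8369 if CriticalTwoPointGSM 8365 is
available: isotropy ⇔ one amplitude identity A(e₁) = A((e₁+e₂)/√2)). [difficulty: open-problem] -/
@[route_item "route-CriticalPhenomena-HelsonAxis"]
def AxisToIsotropicLaw : Prop :=
  (∃ Δ A : ℝ, 0 < A ∧ Filter.Tendsto (fun n : ℕ => Literature.Probability.LatticeModels.criticalTwoPoint 3 (Pi.single (0 : Fin 3) (n : ℤ)) * (n : ℝ) ^ (2 * Δ)) Filter.atTop (nhds A)) → ∃ Δ c : ℝ, 0 < c ∧ Filter.Tendsto (fun x : Literature.Probability.LatticeModels.Site 3 => Literature.Probability.LatticeModels.criticalTwoPoint 3 x * Real.sqrt (∑ i, ((x i : ℝ)) ^ 2) ^ (2 * Δ)) Filter.cofinite (nhds c)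

/-- item stmt-CriticalPhenomena-4497 · crux · rank 4 · open · by planner
why it might fail: It is the conjunct given the two-point law: n ≥ 3 existence/uniqueness, inversion covariance and U₄ ≢ 0 on ℤ³ are each open (ICM 2022 §8.4); inherits ScaleCovarianceNotMoebius, LiouvilleRigidity, IsingTrivialityFromDimensionFour unmitigated.
sources: DuminilCopinICM2022, PolandRychkovVichi2019, AizenmanDuminilCopinAnnals2021, stmt-CriticalPhenomena-0636, stmt-CriticalPhenomena-1982
[crux] (C), the imported complement (lowest rank): for every Δ and c > 0, if G(x)·|x|₂^{2Δ} → c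
along the cofinite filter (the rotation-invariant pure power law, item 0634 with its witnesses
exposed), then there are ρ > 0 on (0,1] and S with: 0 < Δ, HasPointwiseScalingLimit (criticalCorr 3)
ρ S, IsNondegenerateTwoPoint S, IsMoebiusCovariant Δ S, HasNontrivialU4 S — the conjunct with THIS Δ
(ρ(δ) = δ^{−Δ} intended; n = 2 convergence, 1/2 ≤ Δ ≤ 1, scale covariance and translation invariance
are then automatic; what remains is n ≥ 4 existence/uniqueness, O(3) for n ≥ 3, inversion
covariance, U₄ ≢ 0). The conclusion is existential, so no coincident-configuration junk obstructs
it. [difficulty: open-problem] -/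
@[route_item "route-CriticalPhenomena-HelsonAxis"]
def TwoPointSpineComplement : Prop :=
  ∀ Δ c : ℝ, 0 < c → Filter.Tendsto (fun x : Literature.Probability.LatticeModels.Site 3 => Literature.Probability.LatticeModels.criticalTwoPoint 3 x * Real.sqrt (∑ i, ((x i : ℝ)) ^ 2) ^ (2 * Δ)) Filter.cofinite (nhds c) → ∃ (ρ : ℝ → ℝ) (S : Literature.Probability.LatticeModels.CorrFamily 3), (∀ δ ∈ Set.Ioc (0:ℝ) 1, 0 < ρ δ) ∧ 0 < Δ ∧ Literature.Probability.LatticeModels.HasPointwiseScalingLimit (Literature.Probability.LatticeModels.criticalCorr 3) ρ S ∧ Literature.Probability.LatticeModels.IsNondegenerateTwoPoint S ∧ Literature.Probability.LatticeModels.IsMoebiusCovariant Δ S ∧ Literature.Probability.LatticeModels.HasNontrivialU4 S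

/-- item stmt-CriticalPhenomena-4662 · crux · rank 5 · open · by planner
why it might fail: Matching upper and lower powers at β_c(3) are open: the rigorous window is c|x|^{−2} ≤ G ≤ C|x|^{−1} (IR bound, Simon–Lieb) and DC–Panis 2025 only narrows it (η ≤ 1/2 IF η exists); no sliding-scale argument closes the gap in d = 3.
sources: DuminilcopinPanis2025, DuminilCopinICM2022, AizenmanDuminilCopinSidoravicius2015
[support] two-sided pure-power bounds c‖x‖^{-(1+η)} ≤ ⟨σ₀σ_x⟩_{β_c(3)} ≤ C‖x‖^{-(1+η)} for some η
(HasIsingEtaBounds 3 η). Lattice partial engine for ClusterSetTotallyDisconnected: under it every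
scale-covariant cluster point has exponent exactly Δ = (1+η)/2 (λ^{-2(Δ_S−Δ)} ∈ [c/C, C/c] for all λ
> 0 forces Δ_S = Δ), so 𝒞 can only wander at FIXED two-point function. The log-sense exponent of
item 0635 (HasIsingExponentEta) does NOT suffice: g(n) = n^{-2a}·exp(c·√(log n)·sin √(log n)) has η
= 2a−1 yet a whole interval of pure-power cluster exponents. = output (D2) of card
every-scale-regular-multiplicative-fekete; 'under the power-law assumption every scale is regular …
no unconditional proof' (ADC21 §5.6). [difficulty: open-problem] -/
@[route_item "route-CriticalPhenomena-HelsonAxis"]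
def EtaBoundsExist : Prop :=
  ∃ η : ℝ, Literature.Probability.LatticeModels.HasIsingEtaBounds 3 η

/-- item stmt-CriticalPhenomena-17972 · support · rank 9 · closed · proved by Summit.CriticalPhenomena.Ising3DConformalLimit.Cruxes.IsingEuclidUpgradeR2RotInvPowerLaw.TowerProfileRigidity.helsonForcing_proof (prover) · by planner
sources: arXiv:1611.03772, MessagerMiracleSoleJSP1977, arXiv:1912.07973
[support] the forcing theorem on the axis (card (C), partly machine-checked by the card author):
axial Helson positivity with shifts, the in-tree MMS monotonicity of n ↦ ⟨σ₀σ_{ne₁}⟩ and RP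
ratio-continuity g(n+1)/g(n) → 1 give g(n) = n^{−s*}∫u^{κ(n)}dμ with ONE rate s* and g(n) n^{s*} →
m₀ ≥ 0; the two-sided bounds (EtaBoundsExist) force s* = 1 + η = 2Δ and m₀ ≥ c > 0. Pure analysis of
multiplicative moment sequences (Perfekt–Pushnitski Thm 3.3(ii)) + Erdős 1946. [difficulty: M] -/
@[route_item "route-CriticalPhenomena-HelsonAxis"]
def HelsonForcing : Prop :=
  AxialHelsonCone → EtaBoundsExist → ∃ Δ A : ℝ, 0 < A ∧ Filter.Tendsto (fun n : ℕ => Literature.Probability.LatticeModels.criticalTwoPoint 3 (Pi.single (0 : Fin 3) (n : ℤ)) * (n : ℝ) ^ (2 * Δ)) Filter.atTop (nhds A)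

-- `HelsonForcing` holds: proved by `Summit.CriticalPhenomena.Ising3DConformalLimit.Cruxes.IsingEuclidUpgradeR2RotInvPowerLaw.TowerProfileRigidity.helsonForcing_proof` (its module imports this route file, so no `_holds` link can be stated here).

/-- item stmt-CriticalPhenomena-17973 · assembly · rank 1 · open · by planner
sources: DuminilCopinICM2022, arXiv:1611.03772
[assembly] AxialHelsonCone → EtaBoundsExist → HelsonForcing → AxisToIsotropicLaw →
TwoPointSpineComplement → the conjunct Ising3DConformalLimit. -/
@[route_item "route-CriticalPhenomena-HelsonAxis"]
def Assembly : Prop :=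
  AxialHelsonCone → EtaBoundsExist → HelsonForcing → AxisToIsotropicLaw → TwoPointSpineComplement → Ising3DConformalLimit

/-! D-0027 §2.1 — DECIDING THEOREM (planner-authored via `route open/edit --closes-file`; by planner-rbadge-CriticalPhenomena-HelsonAxis-8392421f-g2-0 2026-08-17T10:36:15Z):
its hypotheses are this route's items and its conclusion the sub-problem Statement (glue_lint), and it elaborates with this file. -/

@[closes "route-CriticalPhenomena-HelsonAxis"] theorem closes (hHP : AxialHelsonCone) (hEta : EtaBoundsExist) (hForce : HelsonForcing)
    (hIso : AxisToIsotropicLaw) (hComp : TwoPointSpineComplement) :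
    _root_.Ising3DConformalLimit := by
  -- Pure logic over the five items (no Theorems import). The route's frame item `Assembly`
  -- (rank 1; literally the type of this theorem: AxialHelsonCone → EtaBoundsExist → HelsonForcing →
  -- AxisToIsotropicLaw → TwoPointSpineComplement → Ising3DConformalLimit) is PROVED here and then
  -- applied, so it lies in the cone of the deciding theorem without being assumed (bc6, route-repair
  -- gen 2, 2026-08-17): HelsonForcing turns the axial Helson cone + the η-bounds into the axial pure
  -- power law with amplitude; AxisToIsotropicLaw propagates it to the isotropic cofinite law (Δ, c);
  -- TwoPointSpineComplement at (Δ, c) returns ρ, S with the conjunct's six clauses.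
  have hAsm : Assembly := by
    intro hHP' hEta' hForce' hIso' hComp'
    obtain ⟨Δ, c, hc, hlim⟩ := hIso' (hForce' hHP' hEta')
    obtain ⟨ρ, S, hρ, hΔ, hlimS, hnd, hmob, hU4⟩ := hComp' Δ c hc hlim
    exact ⟨ρ, Δ, S, hρ, hΔ, hlimS, hnd, hmob, hU4⟩
  exact hAsm hHP hEta hForce hIso hComp

end Summit.CriticalPhenomena.Ising3DConformalLimit.Theses.HelsonAxis
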